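import Summits.Schanuel.Schanuel.Theorems.RootDecomp1KHyper18
import Literature.Barriers.Schanuel.NesterenkoModularScopeMeasurePi

/-!
# RootDecomp1KPiCells — §20 «π-CELLS» port (REV B addendum), part 1/1 (lens 6, gen 10 = ROUND 5 theorem round of route-Schanuel-RootDecomp1K on A₄ʰ stmt-Schanuel-33363)

Mechanical port (census-1 gen 8; tools tools/build_dark.py over census/tools/gen7/portkit2.py) of §20 of HOME/decomp-schanuel-lens-6/g10/addendum/PiCells.lean = picells_block.lean
(sha256 2f7fd700…, 9209 l; critic VERDICT 2026-08-30T15:26:18Z ACCEPTED into the ROUND 5 theorem round, PATH T, census C-5) on top of the §17 wave Theorems/RootDecomp1KHyper01…19.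
This part: node lines 9027–9194 (9 declarations: natAbs_coeff_sup_le_mvlen, mvWeakMeasure_piTriple_of_cor52, mvlen_rename_of_injective, MvWeakMeasure.comp_of_injective, mvWeakMeasure_pi_expPi_of_cor52, hyperCell_pi_any …).
The node-local named fact `NP2001Cor52` is replaced by the registered Literature fact
`Literature.Barriers.Schanuel.NesterenkoPhilippon2001_ch3_cor_5_2` (general printed form; the node-local clause is its proved corollary — see the substitution noted below); statements and proofs
are otherwise the node's verbatim, in the wave namespace `Summit.Schanuel.Schanuel.Theorems.RootDecomp1KHyper` (sub-namespace `HyperCell`).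
`--supports stmt-Schanuel-33363` (A₄ʰ HyperLiouvilleSchanuel: decided cells (π, ρπ, w) at n = 3 and (π, ρπ, Γ(1/4), w) at n = 4, ρ hyper-Liouville, mod LNM 1752 Ch. 3 Cor. 5.2). Sorry-free; standard axioms. Nothing here proves Schanuel; rung 0.
Substitutions: `obtain ⟨μ, hμ, hA⟩ := h` → `obtain ⟨μ, hμ, hA⟩ := NesterenkoPhilippon2001_ch3_cor_5_2_pi_of h`
-/

set_option linter.dupNamespace false
set_option linter.unusedSectionVars false

noncomputable section

open Complex IntermediateField Filter Polynomial
open Literature.Barriers.Schanuel (NesterenkoPhilippon2001_ch3_cor_5_2 NesterenkoPhilippon2001_ch3_cor_5_2_pi_of)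

namespace Summit.Schanuel.Schanuel.Theorems.RootDecomp1KHyper

variable {n K : ℕ}

namespace HyperCell

variable {n K : ℕ}

/-- The naive height is at most the length. -/
theorem natAbs_coeff_sup_le_mvlen {n : ℕ} (A : MvPolynomial (Fin n) ℤ) :
    (((A.support.sup fun m => (A.coeff m).natAbs : ℕ) : ℤ) : ℝ) ≤ ((mvlen A : ℤ) : ℝ) := by
  have h0 : 0 ≤ mvlen A := mvlen_nonneg A
  have h1 : A.support.sup (fun m => (A.coeff m).natAbs) ≤ (mvlen A).toNat :=
    Finset.sup_le fun m _ => (Int.le_toNat h0).mpr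
      (by rw [Int.natCast_natAbs]; exact abs_coeff_le_mvlen A m)
  have h2 : ((A.support.sup fun m => (A.coeff m).natAbs : ℕ) : ℤ) ≤ mvlen A :=
    calc ((A.support.sup fun m => (A.coeff m).natAbs : ℕ) : ℤ) ≤ ((mvlen A).toNat : ℤ) := by
          exact_mod_cast h1
      _ = mvlen A := Int.toNat_of_nonneg h0
  exact_mod_cast h2

/-- **Cor 5.2 ⇒ a simultaneous WEAK measure of `(π, e^π, Γ(1/4))`** (`C_d = μ (d + 4)²⁸`,
`k = 28`, from `T := mvlen P + d + 3`, `log T ≤ T ≤ (d + 4)·mvlen P`). -/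
theorem mvWeakMeasure_piTriple_of_cor52 (h : NesterenkoPhilippon2001_ch3_cor_5_2) :
    MvWeakMeasure ![(Real.pi : ℂ), cexp (Real.pi : ℂ), (Real.Gamma (1 / 4) : ℂ)] := by
  obtain ⟨μ, hμ, hA⟩ := NesterenkoPhilippon2001_ch3_cor_5_2_pi_of h
  intro d
  refine ⟨μ * ((d : ℝ) + 4) ^ 28, 28, by positivity, fun P hP hdeg => ?_⟩
  obtain ⟨L, hLdef⟩ : ∃ L : ℝ, L = ((mvlen P : ℤ) : ℝ) := ⟨_, rfl⟩
  have hL1 : 1 ≤ L := by rw [hLdef]; exact_mod_cast one_le_mvlen hP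
  have hHT : max (((P.support.sup fun m => (P.coeff m).natAbs : ℕ) : ℝ) + (P.totalDegree : ℝ))
      (Real.exp 1) ≤ L + d + 3 := by
    refine max_le ?_ ?_
    · have h1 := natAbs_coeff_sup_le_mvlen P
      rw [← hLdef, Int.cast_natCast] at h1
      have hd : (P.totalDegree : ℝ) ≤ d := by exact_mod_cast hdeg
      linarith
    · have := Real.exp_one_lt_d9
      have hd0 : (0 : ℝ) ≤ d := Nat.cast_nonneg d
      linarith
  have h1 := hA P hP (L + d + 3) hHT
  have hd0 : (0 : ℝ) ≤ d := Nat.cast_nonneg d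
  have hT0 : 0 < L + d + 3 := by linarith
  have hT1 : 1 ≤ L + d + 3 := by linarith
  have hlogT : Real.log (L + d + 3) ≤ L + d + 3 :=
    (Real.log_le_sub_one_of_pos hT0).trans (by linarith)
  have hlog0 : 0 ≤ Real.log (L + d + 3) := Real.log_nonneg hT1
  have hTle : L + d + 3 ≤ ((d : ℝ) + 4) * L := by nlinarith
  have key : (L + d + 3) ^ 4 * Real.log (L + d + 3) ^ 24 ≤ ((d : ℝ) + 4) ^ 28 * L ^ 28 :=
    calc (L + d + 3) ^ 4 * Real.log (L + d + 3) ^ 24 ≤ (L + d + 3) ^ 4 * (L + d + 3) ^ 24 := by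
          gcongr
      _ = (L + d + 3) ^ 28 := by ring
      _ ≤ (((d : ℝ) + 4) * L) ^ 28 := pow_le_pow_left₀ hT0.le hTle 28
      _ = ((d : ℝ) + 4) ^ 28 * L ^ 28 := by ring
  have key' := mul_le_mul_of_nonneg_left key hμ.le
  rw [← hLdef]
  calc Real.exp (-(μ * ((d : ℝ) + 4) ^ 28 * L ^ 28))
      ≤ Real.exp (-(μ * (L + d + 3) ^ 4 * Real.log (L + d + 3) ^ 24)) := by
        apply Real.exp_le_exp.mpr
        rw [mul_assoc, mul_assoc]
        linarith
    _ ≤ _ := h1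

/-- `mvlen` is invariant under an injective renaming of the variables. -/
theorem mvlen_rename_of_injective {n m : ℕ} {f : Fin m → Fin n} (hf : Function.Injective f)
    (P : MvPolynomial (Fin m) ℤ) : mvlen (MvPolynomial.rename f P) = mvlen P := by
  unfold mvlen
  rw [MvPolynomial.support_rename_of_injective hf,
    Finset.sum_image fun a _ b _ hab => Finsupp.mapDomain_injective hf hab]
  refine Finset.sum_congr rfl fun d _ => ?_
  rw [MvPolynomial.coeff_rename_mapDomain f hf]

/-- A sub-tuple of a weakly measured tuple is weakly measured. -/
theorem MvWeakMeasure.comp_of_injective {n m : ℕ} {θ : Fin n → ℂ} (hθ : MvWeakMeasure θ)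
    {f : Fin m → Fin n} (hf : Function.Injective f) : MvWeakMeasure (θ ∘ f) := by
  intro d
  obtain ⟨C, k, hC, h⟩ := hθ d
  refine ⟨C, k, hC, fun P hP hdeg => ?_⟩
  have hP' : MvPolynomial.rename f P ≠ 0 := fun h0 =>
    hP (MvPolynomial.rename_injective f hf (by rw [h0, map_zero]))
  have h1 := h (MvPolynomial.rename f P) hP' ((MvPolynomial.totalDegree_rename_le f P).trans hdeg)
  rwa [MvPolynomial.aeval_rename, mvlen_rename_of_injective hf] at h1

/-- **Cor 5.2 ⇒ `MvWeakMeasure (π, e^π)`.** -/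
theorem mvWeakMeasure_pi_expPi_of_cor52 (h : NesterenkoPhilippon2001_ch3_cor_5_2) :
    MvWeakMeasure ![(Real.pi : ℂ), cexp (Real.pi : ℂ)] := by
  have h3 := (mvWeakMeasure_piTriple_of_cor52 h).comp_of_injective
    (Fin.castLE_injective (show 2 ≤ 3 by omega))
  have e : (![(Real.pi : ℂ), cexp (Real.pi : ℂ), (Real.Gamma (1 / 4) : ℂ)] ∘
      Fin.castLE (show 2 ≤ 3 by omega)) = ![(Real.pi : ℂ), cexp (Real.pi : ℂ)] := by
    funext i; fin_cases i <;> rfl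
  rwa [e] at h3

/-- **π-CELL, level 3 (kernel, mod Cor. 5.2).** For hyper-Liouville `ρ` and ANY `w` the triple
`(π, ρπ, w)` is `HyperLinLiouville` and has Schanuel's bound `SB 3`: `ρ`, `π`, `e^π` are
algebraically independent by §17k fed with the simultaneous weak measure of `(π, e^π)`
(`e^π = exp z₀` load-bearing).  For `w ∉ ℚπ + ℚρπ` the triple is ℚ-free: a member of A₄ʰ's
scope at `n = 3` outside the Lindemann–Weierstrass storeys of §17k/§17ℓ. -/
theorem hyperCell_pi_any (h : NesterenkoPhilippon2001_ch3_cor_5_2) {ρ : ℝ} (hρ : HyperLiouville ρ) (w : ℂ) :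
    HyperLinLiouville ![(Real.pi : ℂ), (ρ : ℂ) * Real.pi, w] ∧
      SB 3 ![(Real.pi : ℂ), (ρ : ℂ) * Real.pi, w] := by
  have hπ0 : (Real.pi : ℂ) ≠ 0 := ofReal_ne_zero.mpr Real.pi_ne_zero
  refine ⟨?_, ?_⟩
  · refine hyperLinLiouville_of_prefix (k := 2) (by omega) ?_
    have h2 : (fun i : Fin 2 => (![(Real.pi : ℂ), (ρ : ℂ) * Real.pi, w] : Fin 3 → ℂ)
        (Fin.castLE (show 2 ≤ 3 by omega) i)) = ![(Real.pi : ℂ), (ρ : ℂ) * Real.pi] := by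
      funext i; fin_cases i <;> rfl
    rw [h2]; exact hyperLinLiouville_of_hyperLiouville_ratio hρ _
  · have hz0 : (Real.pi : ℂ) ∈
        adjoin ℚ (SFset ![(Real.pi : ℂ), (ρ : ℂ) * Real.pi, w] ∪ {I}) :=
      mem_adjoin_SFset_I' (Or.inl ⟨0, rfl⟩)
    have hz1 : (ρ : ℂ) * Real.pi ∈
        adjoin ℚ (SFset ![(Real.pi : ℂ), (ρ : ℂ) * Real.pi, w] ∪ {I}) :=
      mem_adjoin_SFset_I' (Or.inl ⟨1, rfl⟩)
    have he0 : cexp (Real.pi : ℂ) ∈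
        adjoin ℚ (SFset ![(Real.pi : ℂ), (ρ : ℂ) * Real.pi, w] ∪ {I}) :=
      mem_adjoin_SFset_I' (Or.inr ⟨0, rfl⟩)
    have hρmem : (ρ : ℂ) ∈ adjoin ℚ (SFset ![(Real.pi : ℂ), (ρ : ℂ) * Real.pi, w] ∪ {I}) := by
      have hdiv := div_mem hz1 hz0
      rwa [mul_div_assoc, div_self hπ0, mul_one] at hdiv
    refine sb_of_hyperLiouville_ratio_of_mvWeakMeasure (n := 2) hρ hρmem
      (mvWeakMeasure_pi_expPi_of_cor52 h) fun j => ?_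
    fin_cases j
    · exact hz0
    · exact he0

/-- **π-CELL, level 4 (kernel, mod Cor. 5.2).** `(π, ρπ, Γ(1/4), w)`, `ρ` hyper-Liouville, ANY `w`:
`HyperLinLiouville` and `SB 4` (`ρ, π, e^π, Γ(1/4)` algebraically independent). -/
theorem hyperCell_pi_gamma_any (h : NesterenkoPhilippon2001_ch3_cor_5_2) {ρ : ℝ} (hρ : HyperLiouville ρ) (w : ℂ) :
    HyperLinLiouville ![(Real.pi : ℂ), (ρ : ℂ) * Real.pi, (Real.Gamma (1 / 4) : ℂ), w] ∧
      SB 4 ![(Real.pi : ℂ), (ρ : ℂ) * Real.pi, (Real.Gamma (1 / 4) : ℂ), w] := by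
  have hπ0 : (Real.pi : ℂ) ≠ 0 := ofReal_ne_zero.mpr Real.pi_ne_zero
  refine ⟨?_, ?_⟩
  · refine hyperLinLiouville_of_prefix (k := 2) (by omega) ?_
    have h2 : (fun i : Fin 2 =>
        (![(Real.pi : ℂ), (ρ : ℂ) * Real.pi, (Real.Gamma (1 / 4) : ℂ), w] : Fin 4 → ℂ)
        (Fin.castLE (show 2 ≤ 4 by omega) i)) = ![(Real.pi : ℂ), (ρ : ℂ) * Real.pi] := by
      funext i; fin_cases i <;> rfl
    rw [h2]; exact hyperLinLiouville_of_hyperLiouville_ratio hρ _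
  · have hz0 : (Real.pi : ℂ) ∈
        adjoin ℚ (SFset ![(Real.pi : ℂ), (ρ : ℂ) * Real.pi, (Real.Gamma (1 / 4) : ℂ), w] ∪ {I}) :=
      mem_adjoin_SFset_I' (Or.inl ⟨0, rfl⟩)
    have hz1 : (ρ : ℂ) * Real.pi ∈
        adjoin ℚ (SFset ![(Real.pi : ℂ), (ρ : ℂ) * Real.pi, (Real.Gamma (1 / 4) : ℂ), w] ∪ {I}) :=
      mem_adjoin_SFset_I' (Or.inl ⟨1, rfl⟩)
    have hz2 : (Real.Gamma (1 / 4) : ℂ) ∈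
        adjoin ℚ (SFset ![(Real.pi : ℂ), (ρ : ℂ) * Real.pi, (Real.Gamma (1 / 4) : ℂ), w] ∪ {I}) :=
      mem_adjoin_SFset_I' (Or.inl ⟨2, rfl⟩)
    have he0 : cexp (Real.pi : ℂ) ∈
        adjoin ℚ (SFset ![(Real.pi : ℂ), (ρ : ℂ) * Real.pi, (Real.Gamma (1 / 4) : ℂ), w] ∪ {I}) :=
      mem_adjoin_SFset_I' (Or.inr ⟨0, rfl⟩)
    have hρmem : (ρ : ℂ) ∈
        adjoin ℚ (SFset ![(Real.pi : ℂ), (ρ : ℂ) * Real.pi, (Real.Gamma (1 / 4) : ℂ), w] ∪ {I}) := by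
      have hdiv := div_mem hz1 hz0
      rwa [mul_div_assoc, div_self hπ0, mul_one] at hdiv
    refine sb_of_hyperLiouville_ratio_of_mvWeakMeasure (n := 3) hρ hρmem
      (mvWeakMeasure_piTriple_of_cor52 h) fun j => ?_
    fin_cases j
    · exact hz0
    · exact he0
    · exact hz2

/-- The `n = 3` instance of A₄ʰ's conclusion (live text shape) at every π-cell, mod Cor. 5.2. -/
theorem hyperLiouvilleSchanuel_at_pi_cell (h : NesterenkoPhilippon2001_ch3_cor_5_2) {ρ : ℝ} (hρ : HyperLiouville ρ)
    (w : ℂ) :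
    (3 : Cardinal) ≤ Algebra.trdeg ℚ ↥(IntermediateField.adjoin ℚ
      (Set.range ![(Real.pi : ℂ), (ρ : ℂ) * Real.pi, w] ∪
        Set.range (Complex.exp ∘ ![(Real.pi : ℂ), (ρ : ℂ) * Real.pi, w]))) :=
  (hyperCell_pi_any h hρ w).2

/-- … e.g. at the named hyper-Liouville constant `λ_H` of §17d: `(π, λ_H π, w)`, any `w`. -/
theorem hyperCell_pi_lambdaH (h : NesterenkoPhilippon2001_ch3_cor_5_2) (w : ℂ) :
    HyperLinLiouville ![(Real.pi : ℂ), (lambdaH : ℂ) * Real.pi, w] ∧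
      SB 3 ![(Real.pi : ℂ), (lambdaH : ℂ) * Real.pi, w] :=
  hyperCell_pi_any h hyperLiouville_lambdaH w

end HyperCell

end Summit.Schanuel.Schanuel.Theorems.RootDecomp1KHyper
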